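import Literature.MathematicalPhysics.QuantumLattice.HubbardTTPrimeThermalStatesEntropyDensity
import Literature.MathematicalPhysics.QuantumLattice.TorusSectorGibbsEntropyRowPressureNumber
import Literature.MathematicalPhysics.QuantumLattice.HubbardTTPrimeGrandCanonicalEnsembleEquivalence
import HarnessLib

/-!
# The entropy density of the CANONICAL thermal torus-limit states of the 2D `t–t'` Hubbard model is
# `p(β; t,t',U; n) + β e_Φ(ω)`

Topic `Literature/MathematicalPhysics/QuantumLattice`; the canonical twin of `HubbardTTPrimeThermalStatesEntropyDensity.lean`
(there: thermal GRAND-CANONICAL states, entropy density `P(β;μ,h) + βu`), for the thermal object of record of the `T > 0`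
certificate family (cell `hubbard-thermal`): torus limits `ω` of the canonical `(rectN n L, S^z = 0)`-sector Gibbs states of
`hubbardTorusTT' L t t' U` at `β > 0`,
`ω.IsTorusLimitOfMixture (sectorGibbsCount n) (sectorGibbsWeightTT' β t t' U n ·) (sectorGibbsVectorTT' t t' U n ·) Ls`, `Ls → ∞`,
and the canonical pressure `p = pressureTT' β t t' U n` (`HubbardTTPrimeThermalPressureLimit`). PROVED (`U ≥ 0`):

* `…sq_mul_le_vonNeumannEntropy_rdm_halfOpenBox_of_sectorGibbs` (`0 ≤ n < 2`): for every box `[0,ℓ)²`, `ℓ ≥ 1`,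
  `ℓ²·(p + β e_Φ(ω)) ≤ S(ω_{[0,ℓ)²})` — the entropy row in the number form (`TorusSectorGibbsEntropyRowPressureNumber`)
  against the near-optimal witness (`GibbsVariationalPrincipleWitness`);
* `…vonNeumannEntropy_rdm_halfOpenBox_le_of_sectorGibbs` (`0 < n < 2`): `S(ω_{[0,ℓ)²}) ≤ ℓ²·(p + β e_Φ(ω)) + β(8|t|+16|t'|)ℓ + 2log(ℓ²+1)`
  — the upper half of the variational principle at the SUPPORTING chemical potential `μ₀` of `p` at `n`
  (`exists_chemicalPotential_pressureTT'_eq`: `p(n) = P(μ₀) − βμ₀n`; `ρ(ω) = n`);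
* `…vonNeumannEntropy_rdm_div_sq_mem_Icc_of_sectorGibbs`: the finite-box two-sided window
  `p + βe_Φ(ω) ≤ S(ω_{[0,ℓ)²})/ℓ² ≤ p + βe_Φ(ω) + (β(8|t|+16|t'|)+4)/ℓ`, and
  **`…tendsto_vonNeumannEntropy_rdm_div_sq_of_sectorGibbs`: `S(ω_{[0,ℓ)²})/ℓ² → p(β;t,t',U;n) + β e_Φ(ω)`** — the ENTROPY
  DENSITY of every canonical thermal torus-limit state exists and equals `p + βe`, i.e. `s = β(e − f)` with `f = −p/β` the
  free energy per site;
* `…vonNeumannEntropy_rdm_div_sq_mem_Icc_of_sectorGibbs_of_windows`: certified windows — a pressure floor `W ≤ p`, a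
  pressure cap `p ≤ Q` and a thermal energy window `e_Φ(ω) ∈ [e₋, e₊]` (the cell's certificate shapes) give
  `W + βe₋ ≤ S(ω_{[0,ℓ)²})/ℓ² ≤ Q + βe₊ + (β(8|t|+16|t'|)+4)/ℓ` for every `ℓ ≥ 1`: the thermal ENTROPY PER SITE at
  `(β; t,t',U; n)` is a certified number from the existing `T > 0` certificates.

Everything is PROVED; no definition, no named fact.

## Mathlib / tree search

REUSED: `IsTranslationInvariant.vonNeumannEntropy_rdm_halfOpenBox_le / _div_sq_le`, `Matrix.le_vonNeumannEntropy_of_forall_witness`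
(`HubbardTTPrimeThermalStatesEntropyDensity`, `GibbsVariationalPrincipleWitness`);
`IsTorusLimitOfMixture.meanEnergy_sub_re_expect_div_le_of_sectorGibbs_box_pressureTT'` (`TorusSectorGibbsEntropyRowPressureNumber`);
`exists_chemicalPotential_pressureTT'_eq` (`HubbardTTPrimeGrandCanonicalEnsembleEquivalence`); `gcPressureTT'Zeeman_zero`
(`HubbardTTPrimeGrandCanonicalPressureZeeman`); `IsTorusLimitOfMixture.density_eq_of_sectorGibbs`, `….isTranslationInvariant`
(`TorusSectorGibbsMixture`, `TorusLimitOfMixtures`); `trace_rdm_mul`, `rdm_posSemidef`, `trace_rdm`. `lean search 'entropy.*sectorGibbs.*rdm'`: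
nothing (2026-08-27).

## References

* H. Araki, H. Moriya, Rev. Math. Phys. 15 (2003) 93, Thm. 3.8, §10–§11. [cite: ArakiMoriya2003, Theorem 3.8 and §10]
* R. B. Israel, *Convexity in the Theory of Lattice Gases* (1979), Lemma II.3.1, Thm. I.2.4. [cite: Israel1979, Lemma II.3.1]
* D. Ruelle, *Statistical Mechanics: Rigorous Results* (1969), §3.4 (canonical vs grand-canonical). [cite: Ruelle1969, §3.4]
-/

noncomputable section

open scoped ComplexOrder BigOperators
open Finset Literature.InformationTheory.Entropy

namespace Literature.MathematicalPhysics.QuantumLattice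

open Matrix HubbardWave0 Literature.Probability.LatticeModels ThermodynamicLimit
open _root_.Filter
open scoped _root_.Topology

namespace InfVolFermionState

variable (t t' : ℝ) {U : ℝ} (hU : 0 ≤ U) {β : ℝ} (hβ : 0 < β) {ω : InfVolFermionState 2} {Ls : ℕ → ℕ}
include hU hβ

/-- **Box entropies of a canonical thermal torus-limit state are at least `|B|(p + βe)`** (`0 ≤ n < 2`, `ℓ ≥ 1`):
`ℓ²·(pressureTT' β t t' U n + β e_Φ(ω)) ≤ S(ω_{[0,ℓ)²})`. [cite: Israel1979, Lemma II.3.1] [cite: ArakiMoriya2003, Theorem 3.8 and §10] -/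
theorem IsTorusLimitOfMixture.sq_mul_le_vonNeumannEntropy_rdm_halfOpenBox_of_sectorGibbs {n : ℝ} (hn0 : 0 ≤ n)
    (hn2 : n < 2)
    (h : ω.IsTorusLimitOfMixture (sectorGibbsCount n) (fun L => sectorGibbsWeightTT' β t t' U n L)
      (fun L => sectorGibbsVectorTT' t t' U n L) Ls)
    (hLs : Tendsto Ls atTop atTop) {ℓ : ℕ} (hℓ : 1 ≤ ℓ) :
    (ℓ : ℝ) ^ 2 * (pressureTT' β t t' U n + β * ω.meanEnergy (hubbardTTPrimeFermionInteraction t t' U) 1) ≤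
      vonNeumannEntropy (ω.rdm (halfOpenBox 2 ℓ)) := by
  have hm : ∀ i : Fin 2, 0 < (fun _ : Fin 2 => ℓ) i := fun _ => hℓ
  have hprod : ∏ i : Fin 2, (((fun _ : Fin 2 => ℓ) i : ℕ) : ℝ) = (ℓ : ℝ) ^ 2 := by simp
  have hℓ2 : (0 : ℝ) < (ℓ : ℝ) ^ 2 := by positivity
  refine le_vonNeumannEntropy_of_forall_witness (ω.rdm_posSemidef _) (ω.trace_rdm _) fun G hG => ?_
  -- the entropy row, read with `halfOpenRect (fun _ => ℓ) = halfOpenBox 2 ℓ` (definitional)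
  have hrow : ω.meanEnergy (hubbardTTPrimeFermionInteraction t t' U) 1 -
        1 / (β * (ℓ : ℝ) ^ 2) * (ω.expect (halfOpenBox 2 ℓ) G).re ≤
      -pressureTT' β t t' U n / β + Real.log (partitionFn 1 G).re / (β * (ℓ : ℝ) ^ 2) := by
    have h0 := h.meanEnergy_sub_re_expect_div_le_of_sectorGibbs_box_pressureTT' t t' hU hn0 hn2 hβ hLs hm hG
    rw [hprod] at h0
    exact h0
  rw [trace_rdm_mul]
  -- multiply the row by `β ℓ² > 0`
  have hβℓ : 0 < β * (ℓ : ℝ) ^ 2 := mul_pos hβ hℓ2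
  have hβ0 : β ≠ 0 := hβ.ne'
  have hℓ0 : (ℓ : ℝ) ≠ 0 := by exact_mod_cast (show ℓ ≠ 0 by omega)
  set A : ℝ := (ω.expect (halfOpenBox 2 ℓ) G).re with hA
  set Z : ℝ := Real.log (partitionFn 1 G).re with hZ
  set e : ℝ := ω.meanEnergy (hubbardTTPrimeFermionInteraction t t' U) 1 with he
  set q : ℝ := pressureTT' β t t' U n with hq
  have key : β * (ℓ : ℝ) ^ 2 * e - A ≤ -(q * (ℓ : ℝ) ^ 2) + Z := by
    have hmul := mul_le_mul_of_nonneg_right hrow hβℓ.le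
    have lhs : (e - 1 / (β * (ℓ : ℝ) ^ 2) * A) * (β * (ℓ : ℝ) ^ 2) = β * (ℓ : ℝ) ^ 2 * e - A := by
      field_simp
    have rhs : (-q / β + Z / (β * (ℓ : ℝ) ^ 2)) * (β * (ℓ : ℝ) ^ 2) = -(q * (ℓ : ℝ) ^ 2) + Z := by
      field_simp
    rw [lhs, rhs] at hmul
    exact hmul
  linarith [key]

/-- **Box entropies of a canonical thermal torus-limit state against `p + βe`, upper bound** (`0 < n < 2`, `ℓ ≥ 1`):
`S(ω_{[0,ℓ)²}) ≤ ℓ²·(pressureTT' β t t' U n + β e_Φ(ω)) + β(8|t|+16|t'|)ℓ + 2 log(ℓ²+1)` (the grand-canonical upper bound at the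
supporting chemical potential of `p` at `n`, where `P(μ₀) − βμ₀n = p(n)`, and `ρ(ω) = n`).
[cite: Israel1979, Lemma II.3.1] [cite: Ruelle1969, §3.4] -/
theorem IsTorusLimitOfMixture.vonNeumannEntropy_rdm_halfOpenBox_le_of_sectorGibbs {n : ℝ} (hn0 : 0 < n) (hn2 : n < 2)
    (h : ω.IsTorusLimitOfMixture (sectorGibbsCount n) (fun L => sectorGibbsWeightTT' β t t' U n L)
      (fun L => sectorGibbsVectorTT' t t' U n L) Ls)
    (hLs : Tendsto Ls atTop atTop) {ℓ : ℕ} (hℓ : 1 ≤ ℓ) :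
    vonNeumannEntropy (ω.rdm (halfOpenBox 2 ℓ)) ≤
      (ℓ : ℝ) ^ 2 * (pressureTT' β t t' U n + β * ω.meanEnergy (hubbardTTPrimeFermionInteraction t t' U) 1) +
        β * ((8 * |t| + 16 * |t'|) * ℓ) + 2 * Real.log ((ℓ : ℝ) ^ 2 + 1) := by
  obtain ⟨μ₀, hμ₀⟩ := exists_chemicalPotential_pressureTT'_eq hβ.le t t' hU hβ hn0 hn2
  have hTI := h.isTranslationInvariant
  have hρ : ω.density = n := h.density_eq_of_sectorGibbs t t' U hn0.le hn2.le β hLs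
  have hup := hTI.vonNeumannEntropy_rdm_halfOpenBox_le hβ.le t t' hU μ₀ 0 hℓ
  rw [gcPressureTT'Zeeman_zero, hρ, zero_mul, sub_zero] at hup
  have e : gcPressureTT' β t t' U μ₀ + β * (ω.meanEnergy (hubbardTTPrimeFermionInteraction t t' U) 1 - μ₀ * n) =
      pressureTT' β t t' U n + β * ω.meanEnergy (hubbardTTPrimeFermionInteraction t t' U) 1 := by
    rw [hμ₀]; ring
  rw [e] at hup
  exact hup

/-- **THE TWO-SIDED FINITE-BOX ENTROPY WINDOW OF A CANONICAL THERMAL STATE** (`0 < n < 2`, `ℓ ≥ 1`):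
`p + βe_Φ(ω) ≤ S(ω_{[0,ℓ)²})/ℓ² ≤ p + βe_Φ(ω) + (β(8|t|+16|t'|)+4)/ℓ`. [cite: ArakiMoriya2003, Theorem 3.8 and §10] -/
theorem IsTorusLimitOfMixture.vonNeumannEntropy_rdm_div_sq_mem_Icc_of_sectorGibbs {n : ℝ} (hn0 : 0 < n) (hn2 : n < 2)
    (h : ω.IsTorusLimitOfMixture (sectorGibbsCount n) (fun L => sectorGibbsWeightTT' β t t' U n L)
      (fun L => sectorGibbsVectorTT' t t' U n L) Ls)
    (hLs : Tendsto Ls atTop atTop) {ℓ : ℕ} (hℓ : 1 ≤ ℓ) :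
    vonNeumannEntropy (ω.rdm (halfOpenBox 2 ℓ)) / (ℓ : ℝ) ^ 2 ∈ Set.Icc
      (pressureTT' β t t' U n + β * ω.meanEnergy (hubbardTTPrimeFermionInteraction t t' U) 1)
      (pressureTT' β t t' U n + β * ω.meanEnergy (hubbardTTPrimeFermionInteraction t t' U) 1 +
        (β * (8 * |t| + 16 * |t'|) + 4) / ℓ) := by
  have hℓpos : (0 : ℝ) < ℓ := by exact_mod_cast hℓ
  have hℓ2 : (0 : ℝ) < (ℓ : ℝ) ^ 2 := by positivity
  constructor
  · rw [le_div_iff₀ hℓ2]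
    have h1 := h.sq_mul_le_vonNeumannEntropy_rdm_halfOpenBox_of_sectorGibbs t t' hU hβ hn0.le hn2 hLs hℓ
    linarith
  · rw [div_le_iff₀ hℓ2]
    have h2 := h.vonNeumannEntropy_rdm_halfOpenBox_le_of_sectorGibbs t t' hU hβ hn0 hn2 hLs hℓ
    have hlog : Real.log ((ℓ : ℝ) ^ 2 + 1) ≤ 2 * ℓ := by
      have hℓ' : (1 : ℝ) ≤ ℓ := by exact_mod_cast hℓ
      have h1 : (ℓ : ℝ) ^ 2 + 1 ≤ ((ℓ : ℝ) + 1) ^ 2 := by nlinarith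
      have h3 : Real.log (((ℓ : ℝ) + 1) ^ 2) = 2 * Real.log ((ℓ : ℝ) + 1) := by
        rw [Real.log_pow]; push_cast; ring
      have h4 : Real.log ((ℓ : ℝ) + 1) ≤ (ℓ : ℝ) + 1 - 1 := Real.log_le_sub_one_of_pos (by positivity)
      linarith [Real.log_le_log (by positivity : (0:ℝ) < (ℓ : ℝ) ^ 2 + 1) h1]
    have e1 : (pressureTT' β t t' U n + β * ω.meanEnergy (hubbardTTPrimeFermionInteraction t t' U) 1 +
        (β * (8 * |t| + 16 * |t'|) + 4) / ℓ) * (ℓ : ℝ) ^ 2 =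
        (ℓ : ℝ) ^ 2 * (pressureTT' β t t' U n + β * ω.meanEnergy (hubbardTTPrimeFermionInteraction t t' U) 1) +
          (β * (8 * |t| + 16 * |t'|) + 4) * ℓ := by
      field_simp
    rw [e1]
    nlinarith [h2, hlog, hβ.le]

/-- **THE ENTROPY DENSITY OF A CANONICAL THERMAL TORUS-LIMIT STATE EXISTS AND EQUALS `p(β;t,t',U;n) + β e_Φ(ω)`**
(`β > 0`, `U ≥ 0`, `0 < n < 2`): `S(ω_{[0,ℓ)²})/ℓ² → pressureTT' β t t' U n + β·e_Φ(ω)`.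
[cite: ArakiMoriya2003, Theorem 3.8 and §10] [cite: Israel1979, Lemma II.3.1] -/
theorem IsTorusLimitOfMixture.tendsto_vonNeumannEntropy_rdm_div_sq_of_sectorGibbs {n : ℝ} (hn0 : 0 < n) (hn2 : n < 2)
    (h : ω.IsTorusLimitOfMixture (sectorGibbsCount n) (fun L => sectorGibbsWeightTT' β t t' U n L)
      (fun L => sectorGibbsVectorTT' t t' U n L) Ls)
    (hLs : Tendsto Ls atTop atTop) :
    Tendsto (fun ℓ : ℕ => vonNeumannEntropy (ω.rdm (halfOpenBox 2 ℓ)) / (ℓ : ℝ) ^ 2) atTop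
      (𝓝 (pressureTT' β t t' U n + β * ω.meanEnergy (hubbardTTPrimeFermionInteraction t t' U) 1)) := by
  set s : ℝ := pressureTT' β t t' U n + β * ω.meanEnergy (hubbardTTPrimeFermionInteraction t t' U) 1 with hs
  set c : ℝ := β * (8 * |t| + 16 * |t'|) + 4 with hc
  have hupper : Tendsto (fun ℓ : ℕ => s + c / (ℓ : ℝ)) atTop (𝓝 s) := by
    have h1 := (tendsto_const_div_atTop_nhds_zero_nat c).const_add s
    rwa [add_zero] at h1
  refine tendsto_of_tendsto_of_tendsto_of_le_of_le' tendsto_const_nhds hupper ?_ ?_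
  · filter_upwards [eventually_ge_atTop 1] with ℓ hℓ
    exact (h.vonNeumannEntropy_rdm_div_sq_mem_Icc_of_sectorGibbs t t' hU hβ hn0 hn2 hLs hℓ).1
  · filter_upwards [eventually_ge_atTop 1] with ℓ hℓ
    exact (h.vonNeumannEntropy_rdm_div_sq_mem_Icc_of_sectorGibbs t t' hU hβ hn0 hn2 hLs hℓ).2

/-- **Certified thermal entropy per site.** For a canonical thermal torus-limit state at `(β; t,t',U; n)` (`0 < n < 2`),
a pressure floor `W ≤ pressureTT' β t t' U n`, a pressure cap `pressureTT' β t t' U n ≤ Q` and a thermal energy window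
`e₋ ≤ e_Φ(ω) ≤ e₊` give, for every `ℓ ≥ 1`, `W + βe₋ ≤ S(ω_{[0,ℓ)²})/ℓ² ≤ Q + βe₊ + (β(8|t|+16|t'|)+4)/ℓ`.
[cite: ArakiMoriya2003, Theorem 3.8 and §10] -/
theorem IsTorusLimitOfMixture.vonNeumannEntropy_rdm_div_sq_mem_Icc_of_sectorGibbs_of_windows {n : ℝ} (hn0 : 0 < n)
    (hn2 : n < 2)
    (h : ω.IsTorusLimitOfMixture (sectorGibbsCount n) (fun L => sectorGibbsWeightTT' β t t' U n L)
      (fun L => sectorGibbsVectorTT' t t' U n L) Ls)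
    (hLs : Tendsto Ls atTop atTop) {ℓ : ℕ} (hℓ : 1 ≤ ℓ) {W Q elo ehi : ℝ}
    (hW : W ≤ pressureTT' β t t' U n) (hQ : pressureTT' β t t' U n ≤ Q)
    (helo : elo ≤ ω.meanEnergy (hubbardTTPrimeFermionInteraction t t' U) 1)
    (hehi : ω.meanEnergy (hubbardTTPrimeFermionInteraction t t' U) 1 ≤ ehi) :
    vonNeumannEntropy (ω.rdm (halfOpenBox 2 ℓ)) / (ℓ : ℝ) ^ 2 ∈
      Set.Icc (W + β * elo) (Q + β * ehi + (β * (8 * |t| + 16 * |t'|) + 4) / ℓ) := by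
  obtain ⟨h1, h2⟩ := h.vonNeumannEntropy_rdm_div_sq_mem_Icc_of_sectorGibbs t t' hU hβ hn0 hn2 hLs hℓ
  have h3 := mul_le_mul_of_nonneg_left helo hβ.le
  have h4 := mul_le_mul_of_nonneg_left hehi hβ.le
  exact ⟨by linarith, by linarith⟩

end InfVolFermionState

end Literature.MathematicalPhysics.QuantumLattice

end
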